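import Mathlib
import Summits.Ventures.PercRepro2.Defs
import Summits.Ventures.PercRepro2.Independence
import Summits.Ventures.PercRepro2.Harris
import Summits.Ventures.PercRepro2.Graph
import Summits.Ventures.PercRepro2.Exploration
import Summits.Ventures.PercRepro2.Events

/-!
# Typed statements of the ranked conjectures (blind cell PercRepro2, typer-1)

One `def … : Prop` per row of `conjectures/CONJECTURES.md` (lead's ranking v1) and per T2
target of `proofs/LEAD-PROOFSHAPES.md`, in the vocabulary of `Events.lean`
(KN24 = Kozma–Nitzan, arXiv:2401.12397).  Every row has an instance-level form
`Row p ends A … : Prop` (one finite graph `ends : E → Sym2 V`, one weight vector `p : E → R`);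
the rows that quantify over all graphs also get a closure `Row_all R : Prop`.  Weights live in a
linearly ordered field `R` (`ℚ` for the exact data, `ℝ` for analysis); admissibility is
`IsProbVec p` (`Harris.lean`).  Decls only — the proofs are the provers' (T2).
-/

namespace Summit.Ventures.PercRepro2

/-! ## The rows -/

section Rows

variable {V : Type*} {E : Type*} [Fintype E] [DecidableEq E]
  {R : Type*} [Field R] [LinearOrder R] [IsStrictOrderedRing R]

/-- **R1 / KN24 Conjecture 1** (post-FKG): `P(v ↔ b) ≥ P(v ↔ A) · min_{a ∈ A} P(a ↔ b)`. -/
def KNConjecture1 (p : E → R) (ends : E → Sym2 V) (A : Finset V) (hA : A.Nonempty) (v b : V) :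
    Prop :=
  prob p (hitEvent ends v A) * A.inf' hA (fun a => prob p (connEvent ends a b)) ≤
    prob p (connEvent ends v b)

/-- **R2 / KN24 Conjecture 2** (pre-FKG, (2)): `P(v ↔ b) ≥ min_{a ∈ A} P(v ↔ A, a ↔ b)`. -/
def KNConjecture2 (p : E → R) (ends : E → Sym2 V) (A : Finset V) (hA : A.Nonempty) (v b : V) :
    Prop :=
  A.inf' hA (fun a => prob p (hitEvent ends v A ∩ connEvent ends a b)) ≤
    prob p (connEvent ends v b)

/-- **R2 / KN24 (3)**, the formally stronger pre-FKG form: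
`P(v ↔ b, v ↔ A) ≥ min_{a ∈ A} P(v ↔ A, a ↔ b)`. -/
def PreFKG (p : E → R) (ends : E → Sym2 V) (A : Finset V) (hA : A.Nonempty) (v b : V) : Prop :=
  A.inf' hA (fun a => prob p (hitEvent ends v A ∩ connEvent ends a b)) ≤
    prob p (connEvent ends v b ∩ hitEvent ends v A)

/-- **R3 Q5-T11**: if the Theorem-11 system has a unique solution `c` (on `A`) with
`Σ c > 0`, then with the normalised coefficients `c̃ = c / Σ c`,
`P(v ↔ b) ≥ Σ_{a ∈ A} c̃_a · P(v ↔ A, a ↔ b)`  (KN24 (38) with these coefficients, for every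
`b`, including `b ∉ A`). -/
def Q5T11 (p : E → R) (ends : E → Sym2 V) (A : Finset V) (v b : V) : Prop :=
  ∀ c : V → R, IsT11Coeff p ends v A c →
    (∀ c' : V → R, IsT11Coeff p ends v A c' → ∀ a ∈ A, c' a = c a) →
    0 < ∑ a ∈ A, c a →
    ∑ a ∈ A, (c a / ∑ a' ∈ A, c a') * prob p (hitEvent ends v A ∩ connEvent ends a b) ≤
      prob p (connEvent ends v b)

/-- **R3, cleared form** (multiply by `Σ c > 0`):
`(Σ_a c_a) · P(v ↔ b) ≥ Σ_a c_a · P(v ↔ A, a ↔ b)`. -/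
def Q5T11' (p : E → R) (ends : E → Sym2 V) (A : Finset V) (v b : V) : Prop :=
  ∀ c : V → R, IsT11Coeff p ends v A c →
    (∀ c' : V → R, IsT11Coeff p ends v A c' → ∀ a ∈ A, c' a = c a) →
    0 < ∑ a ∈ A, c a →
    ∑ a ∈ A, c a * prob p (hitEvent ends v A ∩ connEvent ends a b) ≤
      (∑ a ∈ A, c a) * prob p (connEvent ends v b)

/-- **R4 GOOD-ALL**: `(G, A, v, b)` is *good* in the sense of KN24 §3.2,
`Γ(G, A, v, b) ≤ P(v ↔ b)`, here asked WITHOUT the separation hypothesis of KN24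
(`v` and `b` in different components of `G ∖ A`). -/
def IsGood [Fintype V] [DecidableEq V] (p : E → R) (ends : E → Sym2 V) (A : Finset V)
    (hA : A.Nonempty) (v b : V) : Prop :=
  explorationFunctional p ends A hA v b ≤ prob p (connEvent ends v b)

/-- **R5 / KN24 Theorem 1 in first-hit form**: with the first-hit weights
`h̃_a = h_{{a}} / Σ_{a'} h_{{a'}}`, `P(v ↔ b, v ↔ A) ≥ Σ_a h̃_a · P(v ↔ A, a ↔ b)`
(the lead's identification of KN24's coefficients `α, β` at `|A| = 2`; FALSE at `|A| = 3`). -/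
def FirstHitForm (p : E → R) (ends : E → Sym2 V) (A : Finset V) (v b : V) : Prop :=
  0 < ∑ a ∈ A, firstHitWeight p ends v A a →
    ∑ a ∈ A, (firstHitWeight p ends v A a / ∑ a' ∈ A, firstHitWeight p ends v A a') *
        prob p (hitEvent ends v A ∩ connEvent ends a b) ≤
      prob p (connEvent ends v b ∩ hitEvent ends v A)

/-- **R7 / KN24 Conjecture 4**: for a monotone cluster property `f`,
`E(f(v) · 1{v ↔ A}) ≥ min_{a ∈ A} E(f(a) · 1{v ↔ A})`. -/
def KNConjecture4 (p : E → R) (ends : E → Sym2 V) (A : Finset V) (hA : A.Nonempty) (v : V)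
    (f : V → Config E → R) : Prop :=
  A.inf' hA (hitExpect p ends A v f) ≤ hitExpect p ends A v f v

/-- **R6**: coefficient form of Conjecture 4 with the first-hit weights,
`E(f(v) · 1{v ↔ A}) ≥ Σ_a h̃_a · E(f(a) · 1{v ↔ A})`. -/
def R6FirstHitCoefficient (p : E → R) (ends : E → Sym2 V) (A : Finset V) (v : V)
    (f : V → Config E → R) : Prop :=
  0 < ∑ a ∈ A, firstHitWeight p ends v A a →
    ∑ a ∈ A, (firstHitWeight p ends v A a / ∑ a' ∈ A, firstHitWeight p ends v A a') *
        hitExpect p ends A v f a ≤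
      hitExpect p ends A v f v

/-- **R8 / KN24 Conjecture 6** (contraction step): let `a ∈ A` minimise `P(a ↔ b)`, let
`e = {v, w}` be an edge, and assume `P(x ↔ b) ≥ P(x ↔ A) · P(a ↔ b)` for `x ∈ {v, w}`.
Then the same holds at `v` in the graph with `e` contracted (`p e := 1`). -/
def KNConjecture6 (p : E → R) (ends : E → Sym2 V) (A : Finset V) (b : V) (e : E) : Prop :=
  ∀ v w : V, ends e = s(v, w) → ∀ a ∈ A,
    (∀ a' ∈ A, prob p (connEvent ends a b) ≤ prob p (connEvent ends a' b)) →
    (∀ x : V, x = v ∨ x = w →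
      prob p (hitEvent ends x A) * prob p (connEvent ends a b) ≤ prob p (connEvent ends x b)) →
    prob (Function.update p e 1) (hitEvent ends v A) *
        prob (Function.update p e 1) (connEvent ends a b) ≤
      prob (Function.update p e 1) (connEvent ends v b)

/-- **R9** (conditional rewrite of (3) at a fixed `a ∈ A`):
`P(v ↔ b, v ↔ A, v ↮ a) ≥ P(v ↔ A, v ↮ a, a ↔ b)`. -/
def ConditionalPreFKG (p : E → R) (ends : E → Sym2 V) (A : Finset V) (v b a : V) : Prop :=
  prob p (hitEvent ends v A ∩ (connEvent ends v a)ᶜ ∩ connEvent ends a b) ≤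
    prob p (connEvent ends v b ∩ hitEvent ends v A ∩ (connEvent ends v a)ᶜ)

/-- **R6-core** (lead, `proofs/LEAD-PROOFSHAPES.md` §2): the `|A| = 2` polynomial form of the
coefficient Conjecture-4 inequality for the cluster property `1{C(·) ∈ 𝓔}`.  With
`h_j = P(v ↔ a_j, a₁ ↮ a₂)`, `X_j = P(C(a_j) ∈ 𝓔, v ↔ a_j, a₁ ↮ a₂)` and
`Y_j = P(C(a_{3−j}) ∈ 𝓔, v ↔ a_j, a₁ ↮ a₂)`:  `h₂ · (X₁ − Y₁) + h₁ · (X₂ − Y₂) ≥ 0`. -/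
def R6Core (p : E → R) (ends : E → Sym2 V) (v a₁ a₂ : V) (𝓔 : Set (Set V)) : Prop :=
  0 ≤ prob p (connEvent ends v a₂ ∩ (connEvent ends a₁ a₂)ᶜ) *
        (prob p (clusterInEvent ends a₁ 𝓔 ∩ connEvent ends v a₁ ∩ (connEvent ends a₁ a₂)ᶜ) -
          prob p (clusterInEvent ends a₂ 𝓔 ∩ connEvent ends v a₁ ∩ (connEvent ends a₁ a₂)ᶜ)) +
      prob p (connEvent ends v a₁ ∩ (connEvent ends a₁ a₂)ᶜ) *
        (prob p (clusterInEvent ends a₂ 𝓔 ∩ connEvent ends v a₂ ∩ (connEvent ends a₁ a₂)ᶜ) -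
          prob p (clusterInEvent ends a₁ 𝓔 ∩ connEvent ends v a₂ ∩ (connEvent ends a₁ a₂)ᶜ))

/-- **KN24 Question 5** (literal): there are coefficients `c_a ≥ 0` with `Σ_a c_a = 1`, not
depending on `b`, such that `P(v ↔ b) ≥ Σ_a c_a · P(v ↔ A, a ↔ b)` for every `b`. -/
def Q5Exists (p : E → R) (ends : E → Sym2 V) (A : Finset V) (v : V) : Prop :=
  ∃ c : V → R, (∀ a ∈ A, 0 ≤ c a) ∧ ∑ a ∈ A, c a = 1 ∧
    ∀ b : V, ∑ a ∈ A, c a * prob p (hitEvent ends v A ∩ connEvent ends a b) ≤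
      prob p (connEvent ends v b)

end Rows

/-! ## Closures over all finite graphs -/

section Closures

variable (R : Type) [Field R] [LinearOrder R] [IsStrictOrderedRing R]

/-- R1 for every finite graph, admissible weights, target set `A ≠ ∅` and vertices `v, b`. -/
def KNConjecture1_all : Prop :=
  ∀ (V E : Type) [Fintype V] [DecidableEq V] [Fintype E] [DecidableEq E]
    (ends : E → Sym2 V) (p : E → R), IsProbVec p →
    ∀ (A : Finset V) (hA : A.Nonempty) (v b : V), KNConjecture1 p ends A hA v b

/-- R2 ((3), the formally stronger form) for every finite graph. -/
def PreFKG_all : Prop :=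
  ∀ (V E : Type) [Fintype V] [DecidableEq V] [Fintype E] [DecidableEq E]
    (ends : E → Sym2 V) (p : E → R), IsProbVec p →
    ∀ (A : Finset V) (hA : A.Nonempty) (v b : V), PreFKG p ends A hA v b

/-- R2 restricted to `|A| = 2` — KN24 Theorem 1 (the cell's T2 warm-up target). -/
def PreFKG_card_two : Prop :=
  ∀ (V E : Type) [Fintype V] [DecidableEq V] [Fintype E] [DecidableEq E]
    (ends : E → Sym2 V) (p : E → R), IsProbVec p →
    ∀ (A : Finset V) (hA : A.Nonempty) (v b : V), A.card = 2 → PreFKG p ends A hA v b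

/-- R3 for every finite graph and every `b` (`|A|` unrestricted; the censused cases are
`|A| = 3, 4`). -/
def Q5T11_all : Prop :=
  ∀ (V E : Type) [Fintype V] [DecidableEq V] [Fintype E] [DecidableEq E]
    (ends : E → Sym2 V) (p : E → R), IsProbVec p →
    ∀ (A : Finset V) (v b : V), Q5T11 p ends A v b

/-- R4 GOOD-ALL for every finite graph: `v ∉ A`, `b ∉ A`, `b ≠ v`, no separation hypothesis. -/
def IsGood_all : Prop :=
  ∀ (V E : Type) [Fintype V] [DecidableEq V] [Fintype E] [DecidableEq E]
    (ends : E → Sym2 V) (p : E → R), IsProbVec p →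
    ∀ (A : Finset V) (hA : A.Nonempty) (v b : V), v ∉ A → b ∉ A → b ≠ v →
      IsGood p ends A hA v b

/-- R7 / Conjecture 4 for every finite graph and every monotone cluster property. -/
def KNConjecture4_all : Prop :=
  ∀ (V E : Type) [Fintype V] [DecidableEq V] [Fintype E] [DecidableEq E]
    (ends : E → Sym2 V) (p : E → R), IsProbVec p →
    ∀ (A : Finset V) (hA : A.Nonempty) (v : V) (f : V → Config E → R),
      IsMonotoneClusterProperty ends f → KNConjecture4 p ends A hA v f

/-- R6 (first-hit coefficient form of Conjecture 4) at `|A| = 2`, every finite graph. -/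
def R6FirstHitCoefficient_card_two : Prop :=
  ∀ (V E : Type) [Fintype V] [DecidableEq V] [Fintype E] [DecidableEq E]
    (ends : E → Sym2 V) (p : E → R), IsProbVec p →
    ∀ (A : Finset V) (v : V) (f : V → Config E → R), A.card = 2 →
      IsMonotoneClusterProperty ends f → R6FirstHitCoefficient p ends A v f

/-- **T2 target #1**: R6-core for every finite graph, `a₁ ≠ a₂`, `v ∉ {a₁, a₂}`, `𝓔` an up-set. -/
def R6Core_all : Prop :=
  ∀ (V E : Type) [Fintype V] [DecidableEq V] [Fintype E] [DecidableEq E]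
    (ends : E → Sym2 V) (p : E → R), IsProbVec p →
    ∀ (v a₁ a₂ : V), a₁ ≠ a₂ → v ≠ a₁ → v ≠ a₂ → ∀ 𝓔 : Set (Set V), IsUpperSet 𝓔 →
      R6Core p ends v a₁ a₂ 𝓔

/-- Corollary (i) of R6-core: R6 at `A = {a₁, a₂}` for the cluster properties `1{C(·) ∈ 𝓔}`. -/
def R6Indicator_card_two : Prop :=
  ∀ (V E : Type) [Fintype V] [DecidableEq V] [Fintype E] [DecidableEq E]
    (ends : E → Sym2 V) (p : E → R), IsProbVec p →
    ∀ (v a₁ a₂ : V), a₁ ≠ a₂ → ∀ 𝓔 : Set (Set V), IsUpperSet 𝓔 →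
      R6FirstHitCoefficient p ends {a₁, a₂} v (clusterIndicator ends 𝓔)

/-- Corollary (ii): **KN24 Theorem 7** — Conjecture 4 at `|A| = 2` (proof omitted in print). -/
def KNTheorem7 : Prop :=
  ∀ (V E : Type) [Fintype V] [DecidableEq V] [Fintype E] [DecidableEq E]
    (ends : E → Sym2 V) (p : E → R), IsProbVec p →
    ∀ (v a₁ a₂ : V) (f : V → Config E → R), IsMonotoneClusterProperty ends f →
      KNConjecture4 p ends {a₁, a₂} (Finset.insert_nonempty a₁ {a₂}) v f

/-- Corollary (ii) in the lead's form: **KN24 Theorem 7** for the cluster properties `F ∘ C`,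
`F : Set V → R` monotone under `⊆` (the form proved in `MonotoneCluster.lean`). -/
def KNTheorem7_clusterFun : Prop :=
  ∀ (V E : Type) [Fintype V] [DecidableEq V] [Fintype E] [DecidableEq E]
    (ends : E → Sym2 V) (p : E → R), IsProbVec p →
    ∀ (v a₁ a₂ : V) (F : Set V → R), Monotone F →
      KNConjecture4 p ends {a₁, a₂} (Finset.insert_nonempty a₁ {a₂}) v (clusterFun ends F)

/-- Corollary (iii): **KN24 Theorem 1** — (3) at `A = {a₁, a₂}`. -/
def KNTheorem1 : Prop :=
  ∀ (V E : Type) [Fintype V] [DecidableEq V] [Fintype E] [DecidableEq E]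
    (ends : E → Sym2 V) (p : E → R), IsProbVec p →
    ∀ (v b a₁ a₂ : V), PreFKG p ends {a₁, a₂} (Finset.insert_nonempty a₁ {a₂}) v b

/-- **KN24 Question 5** for every finite graph, source and target set. -/
def Q5Exists_all : Prop :=
  ∀ (V E : Type) [Fintype V] [DecidableEq V] [Fintype E] [DecidableEq E]
    (ends : E → Sym2 V) (p : E → R), IsProbVec p →
    ∀ (A : Finset V) (v : V), A.Nonempty → Q5Exists p ends A v

end Closures

/-! ## Basic reformulations -/

section Lemmas

variable {V : Type*} {E : Type*} [Fintype E] [DecidableEq E]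
  {R : Type*} [Field R] [LinearOrder R] [IsStrictOrderedRing R]

/-- R1 in "some `a ∈ A` works" form (the minimum over a nonempty finite set is attained). -/
lemma KNConjecture1_iff_exists {p : E → R} (hp : IsProbVec p) (ends : E → Sym2 V)
    (A : Finset V) (hA : A.Nonempty) (v b : V) :
    KNConjecture1 p ends A hA v b ↔
      ∃ a ∈ A, prob p (hitEvent ends v A) * prob p (connEvent ends a b) ≤
        prob p (connEvent ends v b) := by
  unfold KNConjecture1
  constructor
  · intro h
    obtain ⟨a, ha, hmin⟩ := Finset.exists_mem_eq_inf' hA fun a => prob p (connEvent ends a b)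
    exact ⟨a, ha, by rw [← hmin]; exact h⟩
  · rintro ⟨a, ha, h⟩
    refine le_trans (mul_le_mul_of_nonneg_left (Finset.inf'_le _ ha) (prob_nonneg hp _)) h

omit [IsStrictOrderedRing R] in
/-- (3) in "some `a ∈ A` works" form. -/
lemma PreFKG_iff_exists (p : E → R) (ends : E → Sym2 V) (A : Finset V) (hA : A.Nonempty)
    (v b : V) :
    PreFKG p ends A hA v b ↔
      ∃ a ∈ A, prob p (hitEvent ends v A ∩ connEvent ends a b) ≤
        prob p (connEvent ends v b ∩ hitEvent ends v A) := by
  unfold PreFKG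
  constructor
  · intro h
    obtain ⟨a, ha, hmin⟩ := Finset.exists_mem_eq_inf' hA
      fun a => prob p (hitEvent ends v A ∩ connEvent ends a b)
    exact ⟨a, ha, by rw [← hmin]; exact h⟩
  · rintro ⟨a, ha, h⟩
    exact le_trans (Finset.inf'_le _ ha) h

/-- (3) implies (2): `P(v ↔ b, v ↔ A) ≤ P(v ↔ b)`. -/
lemma KNConjecture2_of_preFKG {p : E → R} (hp : IsProbVec p) {ends : E → Sym2 V}
    {A : Finset V} {hA : A.Nonempty} {v b : V} (h : PreFKG p ends A hA v b) :
    KNConjecture2 p ends A hA v b :=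
  le_trans h (prob_inter_le_left hp _ _)

/-- (2) implies Conjecture 1 by Harris–FKG: `P(v ↔ A) · P(a ↔ b) ≤ P(v ↔ A, a ↔ b)`. -/
lemma KNConjecture1_of_KNConjecture2 {p : E → R} (hp : IsProbVec p) {ends : E → Sym2 V}
    {A : Finset V} {hA : A.Nonempty} {v b : V} (h : KNConjecture2 p ends A hA v b) :
    KNConjecture1 p ends A hA v b := by
  unfold KNConjecture1
  unfold KNConjecture2 at h
  obtain ⟨a, ha, hmin⟩ := Finset.exists_mem_eq_inf' hA
    fun a => prob p (hitEvent ends v A ∩ connEvent ends a b)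
  rw [hmin] at h
  calc prob p (hitEvent ends v A) * A.inf' hA (fun a => prob p (connEvent ends a b))
      ≤ prob p (hitEvent ends v A) * prob p (connEvent ends a b) :=
        mul_le_mul_of_nonneg_left (Finset.inf'_le _ ha) (prob_nonneg hp _)
    _ ≤ prob p (hitEvent ends v A ∩ connEvent ends a b) :=
        prob_mul_prob_le_prob_inter hp (isUpperSet_hitEvent ends v A)
          (isUpperSet_connEvent ends a b)
    _ ≤ prob p (connEvent ends v b) := h

/-- The two forms of R3 agree (the normalising sum is positive). -/
lemma Q5T11_iff (p : E → R) (ends : E → Sym2 V) (A : Finset V) (v b : V) :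
    Q5T11 p ends A v b ↔ Q5T11' p ends A v b := by
  unfold Q5T11 Q5T11'
  refine forall_congr' fun c => forall_congr' fun _ => forall_congr' fun _ =>
    forall_congr' fun hpos => ?_
  have h1 : ∑ a ∈ A, (c a / ∑ a' ∈ A, c a') * prob p (hitEvent ends v A ∩ connEvent ends a b)
      = (∑ a ∈ A, c a * prob p (hitEvent ends v A ∩ connEvent ends a b)) / ∑ a' ∈ A, c a' := by
    rw [Finset.sum_div]
    exact Finset.sum_congr rfl fun a _ => by rw [div_mul_eq_mul_div]
  rw [h1, div_le_iff₀ hpos, mul_comm (prob p (connEvent ends v b))]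

omit [Fintype E] [DecidableEq E] [Field R] [IsStrictOrderedRing R] in
/-- `F ∘ C` for `F` monotone under `⊆` is a monotone cluster property. -/
lemma isMonotoneClusterProperty_clusterFun (ends : E → Sym2 V) {F : Set V → R}
    (hF : Monotone F) : IsMonotoneClusterProperty ends (clusterFun ends F) where
  mono := fun _ _ _ h => hF h
  eq_of_openAdj := fun _ _ _ h => by
    show F _ = F _
    rw [cluster_eq_of_conn (conn_of_openAdj h)]

omit [Fintype E] [DecidableEq E] in
/-- `1{C(·) ∈ 𝓔}` for an up-set `𝓔` is a monotone cluster property. -/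
lemma isMonotoneClusterProperty_clusterIndicator (ends : E → Sym2 V) {𝓔 : Set (Set V)}
    (h𝓔 : IsUpperSet 𝓔) : IsMonotoneClusterProperty ends (clusterIndicator (R := R) ends 𝓔) where
  mono := fun v ω ξ h => by
    simp only [clusterIndicator]
    by_cases hω : ω ∈ clusterInEvent ends v 𝓔
    · have hξ : ξ ∈ clusterInEvent ends v 𝓔 := h𝓔 h hω
      rw [Set.indicator_of_mem hω, Set.indicator_of_mem hξ]
      exact le_rfl
    · rw [Set.indicator_of_notMem hω]
      exact Set.indicator_apply_nonneg fun _ => zero_le_one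
  eq_of_openAdj := fun v w ω h => by
    have hc : cluster ends ω v = cluster ends ω w := cluster_eq_of_conn (conn_of_openAdj h)
    simp only [clusterIndicator]
    by_cases hv : ω ∈ clusterInEvent ends v 𝓔
    · have hw : ω ∈ clusterInEvent ends w 𝓔 := by
        rw [mem_clusterInEvent, ← hc]; exact hv
      rw [Set.indicator_of_mem hv, Set.indicator_of_mem hw]
    · have hw : ω ∉ clusterInEvent ends w 𝓔 := by
        rw [mem_clusterInEvent, ← hc]; exact hv
      rw [Set.indicator_of_notMem hv, Set.indicator_of_notMem hw]

omit [LinearOrder R] [IsStrictOrderedRing R] in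
/-- `E(1{x ↔ b} · 1{v ↔ A}) = P(x ↔ b, v ↔ A)`. -/
lemma hitExpect_connIndicator (p : E → R) (ends : E → Sym2 V) (A : Finset V) (v b x : V) :
    hitExpect p ends A v (connIndicator ends b) x =
      prob p (connEvent ends x b ∩ hitEvent ends v A) := by
  unfold hitExpect connIndicator
  rw [prob_eq_expect_indicator]
  unfold expect
  exact Finset.sum_congr rfl fun ω _ => by rw [indicator_inter_one]

omit [IsStrictOrderedRing R] in
/-- Conjecture 4 for `f = 1{· ↔ b}` is (3): corollary (iii) from corollary (ii). -/
lemma PreFKG_of_KNConjecture4 {p : E → R} {ends : E → Sym2 V} {A : Finset V} {hA : A.Nonempty}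
    {v b : V} (h : KNConjecture4 p ends A hA v (connIndicator ends b)) : PreFKG p ends A hA v b := by
  unfold KNConjecture4 at h
  unfold PreFKG
  have e : hitExpect p ends A v (connIndicator ends b) =
      fun x => prob p (connEvent ends x b ∩ hitEvent ends v A) :=
    funext (hitExpect_connIndicator p ends A v b)
  rw [e] at h
  have e2 : (fun a => prob p (hitEvent ends v A ∩ connEvent ends a b)) =
      fun a => prob p (connEvent ends a b ∩ hitEvent ends v A) :=
    funext fun a => by rw [Set.inter_comm]
  rw [e2]
  exact h

omit [Fintype E] [DecidableEq E] in
/-- A weighted average with nonnegative weights summing to `1` dominates the minimum. -/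
lemma inf'_le_sum_mul {A : Finset V} (hA : A.Nonempty) {w g : V → R} (hw : ∀ a ∈ A, 0 ≤ w a)
    (hsum : ∑ a ∈ A, w a = 1) : A.inf' hA g ≤ ∑ a ∈ A, w a * g a := by
  calc A.inf' hA g = ∑ a ∈ A, w a * A.inf' hA g := by rw [← Finset.sum_mul, hsum, one_mul]
    _ ≤ ∑ a ∈ A, w a * g a :=
        Finset.sum_le_sum fun a ha => mul_le_mul_of_nonneg_left (Finset.inf'_le _ ha) (hw a ha)

/-- The first-hit coefficient form (R6) implies the min form (Conjecture 4): corollary (ii) from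
corollary (i). -/
lemma KNConjecture4_of_R6FirstHitCoefficient {p : E → R} (hp : IsProbVec p) {ends : E → Sym2 V}
    {A : Finset V} (hA : A.Nonempty) {v : V} {f : V → Config E → R}
    (hpos : 0 < ∑ a ∈ A, firstHitWeight p ends v A a) (h : R6FirstHitCoefficient p ends A v f) :
    KNConjecture4 p ends A hA v f := by
  unfold KNConjecture4
  refine le_trans (inf'_le_sum_mul hA
    (w := fun a => firstHitWeight p ends v A a / ∑ a' ∈ A, firstHitWeight p ends v A a')
    (fun a _ => div_nonneg (prob_nonneg hp _) hpos.le) ?_) (h hpos)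
  rw [← Finset.sum_div, div_self hpos.ne']

end Lemmas

end Summit.Ventures.PercRepro2
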